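import Literature.AnabelianGeometry.EtaleTheta.FrobenioidThetaDivisorSupportQ

/-!
# [EtTh] §5, Proposition 5.3: orders, supports, degrees and integrality over the perfect-`Φ` divisor-support data `Q` (toolkit)

Mochizuki, *The étale theta function …*, Publ. RIMS **45** (2009)
[cite: MochizukiEtTh2009, Prop 5.3 proof p.326–327 (PDF pp.100–101); Prop 3.2 (i) p.296 (PDF p.70); §1 p.240 (PDF p.14)].
Seat abc-iut-L6-d1 (gen 4); proof-only port of this lineage's `FrobenioidThetaDivisorSupportOrders.lean` (p425769, over
the `ℤ`-reading `DivisorSupportData'`, vacuous at perfect `Φ(A_⊚)` by abc-iut-f-127's p436191) to the repair `Q`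
(`FrobenioidThetaDivisorSupportQ.lean`): the additive order `ord`, its values on primary elements (now POSITIVE
RATIONAL) and prime log-divisors, supports, the decomposition of `degOn` into vertical part and cusp sum with their
additivity on elements of finite support, INTEGRAL elements, and — from the printed pins `ncspIso_gen` / `cspIso_gen`
instead of the `ℤ_{≥0}`-line automatism — the compatibility of "the natural isomorphisms between primary components"
with the orders (`ord_ncspIso` / `ord_cspIso`: "the multiplicities … are equal", p.326, for `ℚ_{≥0}`-lines: an
additive bijection of lines fixing the prime log-divisor fixes all coordinates, `x^{den} = gen^{num}`).  No definitions.
HONEST FRAMING: typed ≠ proved; nothing here concerns an actual curve; no side taken on anything downstream. -/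

namespace Literature.AnabelianGeometry.EtaleTheta

open CategoryTheory
open Literature.AlgebraicGeometry.Frobenioids

universe w v v' u u'

namespace FrobenioidThetaDivisors

namespace DivisorSupportDataQ

variable {C : Type u} [Category.{v} C] {D : Type u'} [Category.{v'} D] {𝔉 : ThetaFrobenioid.{w} C D}
variable {𝔓 : DivisorPrimeData 𝔉}

open scoped Classical

/-! ### The additive order -/

/-- `ord` is additive. [cite: MochizukiEtTh2009, Prop 5.3 proof p.326 (PDF p.100)] -/
theorem ord_mul (𝔖 : DivisorSupportDataQ 𝔓) (𝔭 : Primes 𝔉.PhiAcirc) (x y : Algebra.GrothendieckGroup 𝔉.PhiAcirc) :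
    𝔖.ord 𝔭 (x * y) = 𝔖.ord 𝔭 x + 𝔖.ord 𝔭 y := by
  simp only [ord, map_mul, toAdd_mul]

/-- `ord` of an inverse. [cite: MochizukiEtTh2009, Prop 5.3 proof p.326 (PDF p.100)] -/
theorem ord_inv (𝔖 : DivisorSupportDataQ 𝔓) (𝔭 : Primes 𝔉.PhiAcirc) (x : Algebra.GrothendieckGroup 𝔉.PhiAcirc) :
    𝔖.ord 𝔭 x⁻¹ = -𝔖.ord 𝔭 x := by
  simp only [ord, map_inv, toAdd_inv]

/-- `ord` of `1`. [cite: MochizukiEtTh2009, Prop 5.3 proof p.326 (PDF p.100)] -/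
theorem ord_one (𝔖 : DivisorSupportDataQ 𝔓) (𝔭 : Primes 𝔉.PhiAcirc) : 𝔖.ord 𝔭 1 = 0 := by
  simp only [ord, map_one, toAdd_one]

/-- `ord` of a power. [cite: MochizukiEtTh2009, Prop 5.3 proof p.326 (PDF p.100)] -/
theorem ord_pow (𝔖 : DivisorSupportDataQ 𝔓) (𝔭 : Primes 𝔉.PhiAcirc) (x : Algebra.GrothendieckGroup 𝔉.PhiAcirc) (n : ℕ) :
    𝔖.ord 𝔭 (x ^ n) = n * 𝔖.ord 𝔭 x := by
  simp only [ord, map_pow, toAdd_pow, nsmul_eq_mul]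

/-- `ord` of an integer power. [cite: MochizukiEtTh2009, Prop 5.3 proof p.326 (PDF p.100)] -/
theorem ord_zpow (𝔖 : DivisorSupportDataQ 𝔓) (𝔭 : Primes 𝔉.PhiAcirc) (x : Algebra.GrothendieckGroup 𝔉.PhiAcirc) (n : ℤ) :
    𝔖.ord 𝔭 (x ^ n) = n * 𝔖.ord 𝔭 x := by
  simp only [ord, map_zpow, toAdd_zpow, zsmul_eq_mul]

/-- `ord` on the image of `Φ(A_⊚)` is the F2-coordinate.
[cite: MochizukiEtTh2009, Prop 5.3 proof p.326 (PDF p.100)] -/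
theorem ord_of (𝔖 : DivisorSupportDataQ 𝔓) (𝔭 : Primes 𝔉.PhiAcirc) (a : 𝔉.PhiAcirc) :
    𝔖.ord 𝔭 (Algebra.GrothendieckGroup.of a) = Multiplicative.toAdd (𝔖.factor a 𝔭) := by
  have h := Algebra.GrothendieckGroup.lift.symm_apply_apply (ordOf' 𝔖.factor 𝔭)
  rw [Algebra.GrothendieckGroup.lift_symm_apply] at h
  have h' := DFunLike.congr_fun h a
  simp only [MonoidHom.coe_comp, Function.comp_apply] at h'
  change Multiplicative.toAdd
    (Algebra.GrothendieckGroup.lift (ordOf' 𝔖.factor 𝔭) (Algebra.GrothendieckGroup.of a)) = _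
  rw [h']
  rfl

/-- Coordinates of elements of `Φ(A_⊚)` are non-negative.
[cite: MochizukiEtTh2009, Prop 5.3 proof p.326 (PDF p.100)] -/
theorem ord_of_nonneg (𝔖 : DivisorSupportDataQ 𝔓) (𝔭 : Primes 𝔉.PhiAcirc) (a : 𝔉.PhiAcirc) :
    0 ≤ 𝔖.ord 𝔭 (Algebra.GrothendieckGroup.of a) := by
  rw [ord_of]; exact 𝔖.factor_nonneg a 𝔭

/-- The prime log-divisor `gen 𝔭` has order `1` at `𝔭`. [cite: MochizukiEtTh2009, Prop 5.3 p.325 (PDF p.99)] -/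
theorem ord_gen_self (𝔖 : DivisorSupportDataQ 𝔓) (𝔭 : Primes 𝔉.PhiAcirc) :
    𝔖.ord 𝔭 (Algebra.GrothendieckGroup.of (𝔖.gen 𝔭)) = 1 := by
  rw [ord_of, 𝔖.factor_gen_self, toAdd_ofAdd]

/-- The prime log-divisor `gen 𝔭` has order `0` elsewhere. [cite: MochizukiEtTh2009, Prop 5.3 p.325 (PDF p.99)] -/
theorem ord_gen_of_ne (𝔖 : DivisorSupportDataQ 𝔓) {𝔭 𝔮 : Primes 𝔉.PhiAcirc} (h : 𝔮 ≠ 𝔭) :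
    𝔖.ord 𝔮 (Algebra.GrothendieckGroup.of (𝔖.gen 𝔭)) = 0 := by
  rw [ord_of, 𝔖.factor_gen_of_ne h, toAdd_one]

/-- Order of `gen 𝔭` at `𝔮`, as an indicator. [cite: MochizukiEtTh2009, Prop 5.3 p.325 (PDF p.99)] -/
theorem ord_gen (𝔖 : DivisorSupportDataQ 𝔓) (𝔭 𝔮 : Primes 𝔉.PhiAcirc) :
    𝔖.ord 𝔮 (Algebra.GrothendieckGroup.of (𝔖.gen 𝔭)) = if 𝔮 = 𝔭 then 1 else 0 := by
  split_ifs with h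
  · rw [h, ord_gen_self]
  · exact 𝔖.ord_gen_of_ne h

/-- A primary element of `𝔭` has POSITIVE (rational) order at `𝔭` and order `0` elsewhere (`Φ(A_⊚)_𝔭` a
`ℚ_{≥0}`-line).  [cite: MochizukiEtTh2009, Prop 3.2 (i) p.296 (PDF p.70); Prop 5.3 p.325 (PDF p.99)] -/
theorem ord_of_mem_carrier (𝔖 : DivisorSupportDataQ 𝔓) {𝔭 : Primes 𝔉.PhiAcirc} {a : 𝔉.PhiAcirc} (ha : a ∈ 𝔭.carrier) :
    0 < 𝔖.ord 𝔭 (Algebra.GrothendieckGroup.of a) ∧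
      ∀ 𝔮, 𝔮 ≠ 𝔭 → 𝔖.ord 𝔮 (Algebra.GrothendieckGroup.of a) = 0 := by
  obtain ⟨h𝔭, h𝔮⟩ := (𝔖.factor_carrier 𝔭 a).mp ha
  exact ⟨by rwa [ord_of], fun 𝔮 h => by rw [ord_of, h𝔮 𝔮 h, toAdd_one]⟩

/-- Primary elements of `𝔭`, read on the orders: positive order at `𝔭`, order `0` elsewhere.
[cite: MochizukiEtTh2009, Prop 3.2 (i) p.296 (PDF p.70); Prop 5.3 p.325 (PDF p.99)] -/
theorem mem_carrier_iff_ord (𝔖 : DivisorSupportDataQ 𝔓) (𝔭 : Primes 𝔉.PhiAcirc) (a : 𝔉.PhiAcirc) :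
    a ∈ 𝔭.carrier ↔ 0 < 𝔖.ord 𝔭 (Algebra.GrothendieckGroup.of a) ∧
      ∀ 𝔮, 𝔮 ≠ 𝔭 → 𝔖.ord 𝔮 (Algebra.GrothendieckGroup.of a) = 0 := by
  refine ⟨𝔖.ord_of_mem_carrier, fun ⟨h𝔭, h𝔮⟩ => (𝔖.factor_carrier 𝔭 a).mpr ⟨by rwa [ord_of] at h𝔭, fun 𝔮 h => ?_⟩⟩
  have := h𝔮 𝔮 h
  rw [ord_of] at this
  rw [← ofAdd_toAdd (𝔖.factor a 𝔮), this, ofAdd_zero]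

/-- `factor (gen 𝔭 ^ n)` at `𝔭` is `n`. [cite: MochizukiEtTh2009, Prop 5.3 p.325 (PDF p.99)] -/
theorem factor_gen_pow_self (𝔖 : DivisorSupportDataQ 𝔓) (𝔭 : Primes 𝔉.PhiAcirc) (n : ℕ) :
    𝔖.factor (𝔖.gen 𝔭 ^ n) 𝔭 = Multiplicative.ofAdd (n : ℚ) := by
  rw [map_pow, Pi.pow_apply, 𝔖.factor_gen_self, ← ofAdd_nsmul, nsmul_eq_mul, mul_one]

/-- `factor (gen 𝔭 ^ n)` vanishes off `𝔭`. [cite: MochizukiEtTh2009, Prop 5.3 p.325 (PDF p.99)] -/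
theorem factor_gen_pow_of_ne (𝔖 : DivisorSupportDataQ 𝔓) {𝔭 𝔮 : Primes 𝔉.PhiAcirc} (h : 𝔮 ≠ 𝔭) (n : ℕ) : 𝔖.factor (𝔖.gen 𝔭 ^ n) 𝔮 = 1 := by
  rw [map_pow, Pi.pow_apply, 𝔖.factor_gen_of_ne h, one_pow]

/-- Positive powers of the prime log-divisor are primary elements of `𝔭` (the integral points of the line).
[cite: MochizukiEtTh2009, Prop 5.3 p.325 (PDF p.99)] -/
theorem gen_pow_mem_carrier (𝔖 : DivisorSupportDataQ 𝔓) (𝔭 : Primes 𝔉.PhiAcirc) {n : ℕ} (hn : 0 < n) : 𝔖.gen 𝔭 ^ n ∈ 𝔭.carrier :=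
  (𝔖.factor_carrier 𝔭 _).mpr ⟨by rw [factor_gen_pow_self, toAdd_ofAdd]; exact Nat.cast_pos.mpr hn,
    fun _ h => 𝔖.factor_gen_pow_of_ne h n⟩

/-- The prime log-divisor `gen 𝔭` is a primary element of `𝔭`. [cite: MochizukiEtTh2009, Prop 5.3 p.325 (PDF p.99)] -/
theorem gen_mem_carrier (𝔖 : DivisorSupportDataQ 𝔓) (𝔭 : Primes 𝔉.PhiAcirc) : 𝔖.gen 𝔭 ∈ 𝔭.carrier := by
  simpa using 𝔖.gen_pow_mem_carrier 𝔭 one_pos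

/-- The prime log-divisor `gen 𝔭` lies in the primary component `Φ(A_⊚)_𝔭`.
[cite: MochizukiEtTh2009, Prop 5.3 p.325 (PDF p.99)] -/
theorem gen_mem_submonoid (𝔖 : DivisorSupportDataQ 𝔓) (𝔭 : Primes 𝔉.PhiAcirc) : DivisorSupportDataQ.gen 𝔖 𝔭 ∈ 𝔭.submonoid :=
  Submonoid.subset_closure (𝔖.gen_mem_carrier 𝔭)

/-- The exponent of a power of `gen 𝔭` is determined by the `𝔭`-coordinate.
[cite: MochizukiEtTh2009, Prop 5.3 p.325 (PDF p.99)] -/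
theorem eq_of_gen_pow_eq (𝔖 : DivisorSupportDataQ 𝔓) (𝔭 : Primes 𝔉.PhiAcirc) {n m : ℕ} (h : 𝔖.gen 𝔭 ^ n = 𝔖.gen 𝔭 ^ m) : n = m := by
  have h' := congrArg (fun a => Multiplicative.toAdd (𝔖.factor a 𝔭)) h
  simp only [map_pow, Pi.pow_apply, 𝔖.factor_gen_self, toAdd_pow, toAdd_ofAdd, nsmul_eq_mul, mul_one,
    Nat.cast_inj] at h'
  exact h'

/-- An element of `Φ(A_⊚)` is determined by its orders (F2 injective).
[cite: MochizukiEtTh2009, Prop 3.2 (i) p.296 (PDF p.70)] -/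
theorem eq_of_ord_of_eq (𝔖 : DivisorSupportDataQ 𝔓) {a b : 𝔉.PhiAcirc}
    (h : ∀ 𝔭, 𝔖.ord 𝔭 (Algebra.GrothendieckGroup.of a) = 𝔖.ord 𝔭 (Algebra.GrothendieckGroup.of b)) : a = b := by
  refine 𝔖.factor_injective (funext fun 𝔭 => Multiplicative.toAdd.injective ?_)
  rw [← ord_of, ← ord_of]
  exact h 𝔭

/-- An element of `Φ(A_⊚)` all of whose orders vanish is `1`. [cite: MochizukiEtTh2009, Prop 3.2 (i) p.296 (PDF p.70)] -/
theorem eq_one_of_ord_of_eq_zero (𝔖 : DivisorSupportDataQ 𝔓) {a : 𝔉.PhiAcirc} (h : ∀ 𝔭, 𝔖.ord 𝔭 (Algebra.GrothendieckGroup.of a) = 0) :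
    a = 1 :=
  𝔖.eq_of_ord_of_eq fun 𝔭 => by rw [h, map_one, ord_one]

/-- `Φ(A_⊚)_𝔭` (the submonoid generated by the primary elements of `𝔭`) is the set of elements of `Φ(A_⊚)`
supported in `{𝔭}` — the `ℚ_{≥0}`-line of `𝔭` (Prop. 3.2 (i)).  [cite: MochizukiEtTh2009, Prop 3.2 (i) p.296 (PDF p.70); Prop 5.3 p.325 (PDF p.99)] -/
theorem mem_submonoid_iff_ord (𝔖 : DivisorSupportDataQ 𝔓) (𝔭 : Primes 𝔉.PhiAcirc) (a : 𝔉.PhiAcirc) :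
    a ∈ 𝔭.submonoid ↔ ∀ 𝔮, 𝔮 ≠ 𝔭 → 𝔖.ord 𝔮 (Algebra.GrothendieckGroup.of a) = 0 := by
  constructor
  · intro ha
    induction ha using Submonoid.closure_induction with
    | mem x hx => exact (𝔖.ord_of_mem_carrier hx).2
    | one => intro 𝔮 _; rw [map_one, ord_one]
    | mul x y _ _ hx hy => intro 𝔮 h; rw [map_mul, ord_mul, hx 𝔮 h, hy 𝔮 h, add_zero]
  · intro ha
    rcases (𝔖.ord_of_nonneg 𝔭 a).eq_or_lt with h0 | hpos
    · have : a = 1 := 𝔖.eq_one_of_ord_of_eq_zero fun 𝔮 => by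
        rcases eq_or_ne 𝔮 𝔭 with rfl | h
        · exact h0.symm
        · exact ha 𝔮 h
      rw [this]; exact one_mem _
    · exact Submonoid.subset_closure ((𝔖.mem_carrier_iff_ord 𝔭 a).mpr ⟨hpos, ha⟩)

/-- Positive powers of `gen 𝔭` lie in `Φ(A_⊚)_𝔭`. [cite: MochizukiEtTh2009, Prop 5.3 p.325 (PDF p.99)] -/
theorem gen_pow_mem_submonoid (𝔖 : DivisorSupportDataQ 𝔓) (𝔭 : Primes 𝔉.PhiAcirc) (n : ℕ) : 𝔖.gen 𝔭 ^ n ∈ 𝔭.submonoid :=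
  pow_mem (𝔖.gen_mem_submonoid 𝔭) n

/-! ### The natural isomorphisms between primary components and the orders (from the PINS) -/

/-- **A `gen`-pinned isomorphism of primary components maps `gen 𝔭 ^ n ↦ gen 𝔮 ^ n`.**
[cite: MochizukiEtTh2009, Prop 5.3 (ii)(iii) p.325 (PDF p.99); Rmk 3.8.2] -/
theorem submonoidEquiv_gen_pow_of_gen (𝔖 : DivisorSupportDataQ 𝔓) (𝔭 𝔮 : Primes 𝔉.PhiAcirc) (e : 𝔭.submonoid ≃* 𝔮.submonoid)
    (he : ∀ x : 𝔭.submonoid, (x : 𝔉.PhiAcirc) = 𝔖.gen 𝔭 → (e x : 𝔉.PhiAcirc) = 𝔖.gen 𝔮) (n : ℕ)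
    (a : 𝔭.submonoid) (ha : (a : 𝔉.PhiAcirc) = 𝔖.gen 𝔭 ^ n) : (e a : 𝔉.PhiAcirc) = 𝔖.gen 𝔮 ^ n := by
  have : a = ⟨𝔖.gen 𝔭, 𝔖.gen_mem_submonoid 𝔭⟩ ^ n := Subtype.ext (by rw [ha]; rfl)
  rw [this, map_pow, SubmonoidClass.coe_pow, he _ rfl]

/-- **A `gen`-pinned isomorphism of primary components preserves the coordinates** ("the multiplicities … are
equal", p.326 (PDF p.100), for the `ℚ_{≥0}`-lines): `ord_𝔮 (e x) = ord_𝔭 x` — an additive map of `ℚ_{≥0}`-lines fixing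
`1` is the identity on coordinates (`x^{den} = gen^{num}`).  [cite: MochizukiEtTh2009, Prop 5.3 proof p.326 (PDF p.100); Rmk 3.8.2] -/
theorem ord_submonoidEquiv_of_gen (𝔖 : DivisorSupportDataQ 𝔓) (𝔭 𝔮 : Primes 𝔉.PhiAcirc) (e : 𝔭.submonoid ≃* 𝔮.submonoid)
    (he : ∀ x : 𝔭.submonoid, (x : 𝔉.PhiAcirc) = 𝔖.gen 𝔭 → (e x : 𝔉.PhiAcirc) = 𝔖.gen 𝔮) (x : 𝔭.submonoid) :
    𝔖.ord 𝔮 (Algebra.GrothendieckGroup.of (e x : 𝔉.PhiAcirc)) = 𝔖.ord 𝔭 (Algebra.GrothendieckGroup.of (x : 𝔉.PhiAcirc)) := by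
  set r : ℚ := 𝔖.ord 𝔭 (Algebra.GrothendieckGroup.of (x : 𝔉.PhiAcirc)) with hr
  have hr0 : 0 ≤ r := 𝔖.ord_of_nonneg 𝔭 _
  -- `x ^ den = gen 𝔭 ^ num`
  obtain ⟨num, hnum⟩ : ∃ num : ℕ, (num : ℤ) = r.num := Int.eq_ofNat_of_zero_le (Rat.num_nonneg.mpr hr0) |>.imp
    fun _ h => h.symm
  have hx𝔮 : ∀ 𝔮', 𝔮' ≠ 𝔭 → 𝔖.ord 𝔮' (Algebra.GrothendieckGroup.of (x : 𝔉.PhiAcirc)) = 0 :=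
    (𝔖.mem_submonoid_iff_ord 𝔭 _).mp x.2
  have hpow : (x : 𝔉.PhiAcirc) ^ r.den = 𝔖.gen 𝔭 ^ num := by
    refine 𝔖.eq_of_ord_of_eq fun 𝔮' => ?_
    rw [map_pow, map_pow, ord_pow, ord_pow, ord_gen]
    rcases eq_or_ne 𝔮' 𝔭 with rfl | h
    · rw [if_pos rfl, mul_one, ← hr]
      have h1 : (r.den : ℚ) * r = r.num := by
        have := Rat.mul_den_eq_num r; rw [mul_comm] at this; exact this
      rw [h1]; exact_mod_cast hnum.symm
    · rw [if_neg h, hx𝔮 𝔮' h, mul_zero, mul_zero]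
  -- apply `e`
  have hex : ((e x : 𝔮.submonoid) : 𝔉.PhiAcirc) ^ r.den = 𝔖.gen 𝔮 ^ num := by
    rw [← SubmonoidClass.coe_pow, ← map_pow]
    exact 𝔖.submonoidEquiv_gen_pow_of_gen 𝔭 𝔮 e he num (x ^ r.den) (by rw [SubmonoidClass.coe_pow, hpow])
  have h2 := congrArg (fun c : 𝔉.PhiAcirc => 𝔖.ord 𝔮 (Algebra.GrothendieckGroup.of c)) hex
  simp only [map_pow, ord_pow, ord_gen_self, mul_one] at h2
  -- `den * ord_𝔮 (e x) = num`
  have hden : (0 : ℚ) < r.den := Nat.cast_pos.mpr r.den_pos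
  have h3 : (r.den : ℚ) * r = (num : ℚ) := by
    have := Rat.mul_den_eq_num r; rw [mul_comm] at this; rw [this]; exact_mod_cast hnum.symm
  have : (r.den : ℚ) * 𝔖.ord 𝔮 (Algebra.GrothendieckGroup.of (e x : 𝔉.PhiAcirc)) = (r.den : ℚ) * r := by
    rw [h2, h3]
  exact mul_left_cancel₀ hden.ne' this

/-- **The natural isomorphism of (ii) maps `gen 𝔭 ^ n ↦ gen 𝔮 ^ n`** (pin `ncspIso_gen`).
[cite: MochizukiEtTh2009, Prop 5.3 (ii) p.325 (PDF p.99); Rmk 3.8.2] -/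
theorem ncspIso_gen_pow (𝔖 : DivisorSupportDataQ 𝔓) (𝔭 𝔮 : Primes 𝔉.PhiAcirc) (h𝔭 : ¬ 𝔓.IsCuspidal 𝔭) (h𝔮 : ¬ 𝔓.IsCuspidal 𝔮) (n : ℕ)
    (a : 𝔭.submonoid) (ha : (a : 𝔉.PhiAcirc) = 𝔖.gen 𝔭 ^ n) :
    (𝔓.ncspIso 𝔭 𝔮 h𝔭 h𝔮 a : 𝔉.PhiAcirc) = 𝔖.gen 𝔮 ^ n :=
  𝔖.submonoidEquiv_gen_pow_of_gen 𝔭 𝔮 _ (𝔖.ncspIso_gen 𝔭 𝔮 h𝔭 h𝔮) n a ha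

/-- **The natural isomorphism of (iii) maps `gen 𝔭 ^ n ↦ gen 𝔮 ^ n`** (pin `cspIso_gen`).
[cite: MochizukiEtTh2009, Prop 5.3 (iii) p.325 (PDF p.99)] -/
theorem cspIso_gen_pow (𝔖 : DivisorSupportDataQ 𝔓) (𝔭 𝔮 : Primes 𝔉.PhiAcirc) (h𝔭 : 𝔓.IsCuspidal 𝔭) (h𝔮 : 𝔓.IsCuspidal 𝔮) (n : ℕ)
    (a : 𝔭.submonoid) (ha : (a : 𝔉.PhiAcirc) = 𝔖.gen 𝔭 ^ n) :
    (𝔓.cspIso 𝔭 𝔮 h𝔭 h𝔮 a : 𝔉.PhiAcirc) = 𝔖.gen 𝔮 ^ n :=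
  𝔖.submonoidEquiv_gen_pow_of_gen 𝔭 𝔮 _ (𝔖.cspIso_gen 𝔭 𝔮 h𝔭 h𝔮) n a ha

/-- **"The multiplicities … are equal" for correspondents under (ii)**: `ord_𝔮 (ncspIso a) = ord_𝔭 a`.
[cite: MochizukiEtTh2009, Prop 5.3 proof p.326 (PDF p.100); Rmk 3.8.2] -/
theorem ord_ncspIso (𝔖 : DivisorSupportDataQ 𝔓) (𝔭 𝔮 : Primes 𝔉.PhiAcirc) (h𝔭 : ¬ 𝔓.IsCuspidal 𝔭) (h𝔮 : ¬ 𝔓.IsCuspidal 𝔮) (a : 𝔭.submonoid) :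
    𝔖.ord 𝔮 (Algebra.GrothendieckGroup.of (𝔓.ncspIso 𝔭 𝔮 h𝔭 h𝔮 a : 𝔉.PhiAcirc)) =
      𝔖.ord 𝔭 (Algebra.GrothendieckGroup.of (a : 𝔉.PhiAcirc)) :=
  𝔖.ord_submonoidEquiv_of_gen 𝔭 𝔮 _ (𝔖.ncspIso_gen 𝔭 𝔮 h𝔭 h𝔮) a

/-- **"The multiplicities … are equal" for correspondents under (iii)**: `ord_𝔮 (cspIso a) = ord_𝔭 a`.
[cite: MochizukiEtTh2009, Prop 5.3 proof p.326 (PDF p.100)] -/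
theorem ord_cspIso (𝔖 : DivisorSupportDataQ 𝔓) (𝔭 𝔮 : Primes 𝔉.PhiAcirc) (h𝔭 : 𝔓.IsCuspidal 𝔭) (h𝔮 : 𝔓.IsCuspidal 𝔮) (a : 𝔭.submonoid) :
    𝔖.ord 𝔮 (Algebra.GrothendieckGroup.of (𝔓.cspIso 𝔭 𝔮 h𝔭 h𝔮 a : 𝔉.PhiAcirc)) =
      𝔖.ord 𝔭 (Algebra.GrothendieckGroup.of (a : 𝔉.PhiAcirc)) :=
  𝔖.ord_submonoidEquiv_of_gen 𝔭 𝔮 _ (𝔖.cspIso_gen 𝔭 𝔮 h𝔭 h𝔮) a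

/-! ### Supports -/

/-- Membership in the support. [cite: MochizukiEtTh2009, Prop 5.3 proof p.326 (PDF p.100)] -/
theorem mem_supp_iff (𝔖 : DivisorSupportDataQ 𝔓) (𝔭 : Primes 𝔉.PhiAcirc) (x : Algebra.GrothendieckGroup 𝔉.PhiAcirc) :
    𝔭 ∈ 𝔖.supp x ↔ 𝔖.ord 𝔭 x ≠ 0 := by
  simp only [supp, suppOf', Set.mem_setOf_eq, ord, ordGp, ne_eq]
  exact ⟨fun h h' => h (by rw [← ofAdd_toAdd (ordGpOf' 𝔖.factor 𝔭 x), h', ofAdd_zero]),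
    fun h h' => h (by rw [h', toAdd_one])⟩

/-- Off the support the order vanishes. [cite: MochizukiEtTh2009, Prop 5.3 proof p.326 (PDF p.100)] -/
theorem ord_eq_zero_of_notMem_supp (𝔖 : DivisorSupportDataQ 𝔓) {𝔭 : Primes 𝔉.PhiAcirc} {x : Algebra.GrothendieckGroup 𝔉.PhiAcirc}
    (h : 𝔭 ∉ 𝔖.supp x) : 𝔖.ord 𝔭 x = 0 := by
  by_contra h'; exact h ((𝔖.mem_supp_iff 𝔭 x).mpr h')

/-- The support of a product is contained in the union of the supports.
[cite: MochizukiEtTh2009, Prop 5.3 proof p.326 (PDF p.100)] -/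
theorem supp_mul_subset (𝔖 : DivisorSupportDataQ 𝔓) (x y : Algebra.GrothendieckGroup 𝔉.PhiAcirc) :
    𝔖.supp (x * y) ⊆ 𝔖.supp x ∪ 𝔖.supp y := by
  intro 𝔭 h
  rw [𝔖.mem_supp_iff, ord_mul] at h
  by_contra h'
  rw [Set.mem_union, not_or, 𝔖.mem_supp_iff, 𝔖.mem_supp_iff, not_not, not_not] at h'
  exact h (by rw [h'.1, h'.2, add_zero])

/-- The support of an inverse. [cite: MochizukiEtTh2009, Prop 5.3 proof p.326 (PDF p.100)] -/
theorem supp_inv (𝔖 : DivisorSupportDataQ 𝔓) (x : Algebra.GrothendieckGroup 𝔉.PhiAcirc) : 𝔖.supp x⁻¹ = 𝔖.supp x := by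
  ext 𝔭; simp only [𝔖.mem_supp_iff, ord_inv, ne_eq, neg_eq_zero]

/-- The support of a primary element of `𝔭` is `{𝔭}`.
[cite: MochizukiEtTh2009, Prop 5.3 proof p.326 (PDF p.100)] -/
theorem supp_of_mem_carrier (𝔖 : DivisorSupportDataQ 𝔓) {𝔭 : Primes 𝔉.PhiAcirc} {a : 𝔉.PhiAcirc} (ha : a ∈ 𝔭.carrier) :
    𝔖.supp (Algebra.GrothendieckGroup.of a) = {𝔭} := by
  obtain ⟨h𝔭, h𝔮⟩ := 𝔖.ord_of_mem_carrier ha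
  ext 𝔮
  rw [𝔖.mem_supp_iff, Set.mem_singleton_iff]
  by_cases h : 𝔮 = 𝔭
  · subst h; simp only [ne_eq, h𝔭.ne', not_false_eq_true]
  · simp only [h𝔮 𝔮 h, ne_eq, not_true_eq_false, h]

/-- The support of `gen 𝔭` is `{𝔭}`. [cite: MochizukiEtTh2009, Prop 5.3 p.325 (PDF p.99)] -/
theorem supp_gen (𝔖 : DivisorSupportDataQ 𝔓) (𝔭 : Primes 𝔉.PhiAcirc) : 𝔖.supp (Algebra.GrothendieckGroup.of (𝔖.gen 𝔭)) = {𝔭} :=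
  𝔖.supp_of_mem_carrier (𝔖.gen_mem_carrier 𝔭)

/-- Coprimality: `supp y ⊆ supp (y · x⁻¹)` when `x, y` have disjoint supports (so finiteness descends to `y`).
[cite: MochizukiEtTh2009, Prop 5.3 proof p.326 (PDF p.100)] -/
theorem supp_subset_of_coprime (𝔖 : DivisorSupportDataQ 𝔓) {x y : Algebra.GrothendieckGroup 𝔉.PhiAcirc} (h : CoprimeOf' 𝔖.factor x y) :
    𝔖.supp y ⊆ 𝔖.supp (y * x⁻¹) := by
  intro 𝔭 h𝔭
  have hx : 𝔭 ∉ 𝔖.supp x := fun h' => Set.disjoint_left.mp h h' h𝔭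
  rw [𝔖.mem_supp_iff] at h𝔭 ⊢
  rwa [ord_mul, ord_inv, 𝔖.ord_eq_zero_of_notMem_supp hx, neg_zero, add_zero]

/-- A cuspidal element has order `0` at every non-cuspidal prime.
[cite: MochizukiEtTh2009, Prop 5.3 proof p.326 (PDF p.100)] -/
theorem ord_eq_zero_of_isCuspidalGp (𝔖 : DivisorSupportDataQ 𝔓) {x : Algebra.GrothendieckGroup 𝔉.PhiAcirc} (hx : 𝔖.IsCuspidalGp x)
    {𝔫 : Primes 𝔉.PhiAcirc} (h𝔫 : ¬ 𝔓.IsCuspidal 𝔫) : 𝔖.ord 𝔫 x = 0 :=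
  𝔖.ord_eq_zero_of_notMem_supp fun h => h𝔫 (hx 𝔫 h)

/-! ### The two halves of the degree: vertical part and cusp sum -/

/-- `degOn` = vertical part + cusp sum, the cusp sum written as a `finsum` over the fibre TYPE.
[cite: MochizukiEtTh2009, §1 p.240 (PDF p.14)] -/
theorem degOn_eq (𝔖 : DivisorSupportDataQ 𝔓) (𝔫 : {p : Primes 𝔉.PhiAcirc // ¬ 𝔓.IsCuspidal p}) (x : Algebra.GrothendieckGroup 𝔉.PhiAcirc) :
    𝔖.degOn 𝔫 x = (𝔖.ord (ncspShift 𝔓 (-1) 𝔫).1 x - 2 * 𝔖.ord 𝔫.1 x + 𝔖.ord (ncspShift 𝔓 1 𝔫).1 x) +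
      ∑ᶠ 𝔠 : {𝔠 : {p : Primes 𝔉.PhiAcirc // 𝔓.IsCuspidal p} // 𝔓.cspToNcsp 𝔠 = 𝔫}, 𝔖.ord 𝔠.1.1 x := by
  rw [degOn, ← finsum_set_coe_eq_finsum_mem]
  rfl

/-- The vertical part is additive. [cite: MochizukiEtTh2009, §1 p.240 (PDF p.14)] -/
theorem vert_mul (𝔖 : DivisorSupportDataQ 𝔓) (𝔫 : {p : Primes 𝔉.PhiAcirc // ¬ 𝔓.IsCuspidal p}) (x y : Algebra.GrothendieckGroup 𝔉.PhiAcirc) :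
    𝔖.ord (ncspShift 𝔓 (-1) 𝔫).1 (x * y) - 2 * 𝔖.ord 𝔫.1 (x * y) + 𝔖.ord (ncspShift 𝔓 1 𝔫).1 (x * y) =
      (𝔖.ord (ncspShift 𝔓 (-1) 𝔫).1 x - 2 * 𝔖.ord 𝔫.1 x + 𝔖.ord (ncspShift 𝔓 1 𝔫).1 x) +
        (𝔖.ord (ncspShift 𝔓 (-1) 𝔫).1 y - 2 * 𝔖.ord 𝔫.1 y + 𝔖.ord (ncspShift 𝔓 1 𝔫).1 y) := by
  simp only [ord_mul]; ring

/-- The vertical part of an inverse. [cite: MochizukiEtTh2009, §1 p.240 (PDF p.14)] -/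
theorem vert_inv (𝔖 : DivisorSupportDataQ 𝔓) (𝔫 : {p : Primes 𝔉.PhiAcirc // ¬ 𝔓.IsCuspidal p}) (x : Algebra.GrothendieckGroup 𝔉.PhiAcirc) :
    𝔖.ord (ncspShift 𝔓 (-1) 𝔫).1 x⁻¹ - 2 * 𝔖.ord 𝔫.1 x⁻¹ + 𝔖.ord (ncspShift 𝔓 1 𝔫).1 x⁻¹ =
      -(𝔖.ord (ncspShift 𝔓 (-1) 𝔫).1 x - 2 * 𝔖.ord 𝔫.1 x + 𝔖.ord (ncspShift 𝔓 1 𝔫).1 x) := by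
  simp only [ord_inv]; ring

/-- The vertical part vanishes on cuspidal elements.
[cite: MochizukiEtTh2009, Prop 5.3 proof p.326 (PDF p.100)] -/
theorem vert_eq_zero_of_isCuspidalGp (𝔖 : DivisorSupportDataQ 𝔓) (𝔫 : {p : Primes 𝔉.PhiAcirc // ¬ 𝔓.IsCuspidal p})
    {x : Algebra.GrothendieckGroup 𝔉.PhiAcirc} (hx : 𝔖.IsCuspidalGp x) :
    𝔖.ord (ncspShift 𝔓 (-1) 𝔫).1 x - 2 * 𝔖.ord 𝔫.1 x + 𝔖.ord (ncspShift 𝔓 1 𝔫).1 x = 0 := by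
  rw [𝔖.ord_eq_zero_of_isCuspidalGp hx (ncspShift 𝔓 (-1) 𝔫).2, 𝔖.ord_eq_zero_of_isCuspidalGp hx 𝔫.2,
    𝔖.ord_eq_zero_of_isCuspidalGp hx (ncspShift 𝔓 1 𝔫).2]
  ring

/-- The cusp-order function of an element of finite support has finite support.
[cite: MochizukiEtTh2009, Prop 5.3 proof p.326 (PDF p.100)] -/
theorem hasFiniteSupport_cuspOrd (𝔖 : DivisorSupportDataQ 𝔓) (𝔫 : {p : Primes 𝔉.PhiAcirc // ¬ 𝔓.IsCuspidal p})
    {x : Algebra.GrothendieckGroup 𝔉.PhiAcirc} (hx : (𝔖.supp x).Finite) :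
    (Function.support fun 𝔠 : {𝔠 : {p : Primes 𝔉.PhiAcirc // 𝔓.IsCuspidal p} // 𝔓.cspToNcsp 𝔠 = 𝔫} =>
      𝔖.ord 𝔠.1.1 x).Finite := by
  apply (hx.preimage
    (f := fun 𝔠 : {𝔠 : {p : Primes 𝔉.PhiAcirc // 𝔓.IsCuspidal p} // 𝔓.cspToNcsp 𝔠 = 𝔫} => 𝔠.1.1)
    (Set.injOn_of_injective fun a b h => Subtype.ext (Subtype.ext h))).subset
  intro 𝔠 h𝔠
  exact (𝔖.mem_supp_iff _ _).mpr h𝔠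

/-- The cusp sum is additive on elements of finite support. [cite: MochizukiEtTh2009, §1 p.240 (PDF p.14)] -/
theorem cuspSum_mul (𝔖 : DivisorSupportDataQ 𝔓) (𝔫 : {p : Primes 𝔉.PhiAcirc // ¬ 𝔓.IsCuspidal p})
    {x y : Algebra.GrothendieckGroup 𝔉.PhiAcirc} (hx : (𝔖.supp x).Finite) (hy : (𝔖.supp y).Finite) :
    ∑ᶠ 𝔠 : {𝔠 : {p : Primes 𝔉.PhiAcirc // 𝔓.IsCuspidal p} // 𝔓.cspToNcsp 𝔠 = 𝔫}, 𝔖.ord 𝔠.1.1 (x * y) =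
      (∑ᶠ 𝔠 : {𝔠 : {p : Primes 𝔉.PhiAcirc // 𝔓.IsCuspidal p} // 𝔓.cspToNcsp 𝔠 = 𝔫}, 𝔖.ord 𝔠.1.1 x) +
        ∑ᶠ 𝔠 : {𝔠 : {p : Primes 𝔉.PhiAcirc // 𝔓.IsCuspidal p} // 𝔓.cspToNcsp 𝔠 = 𝔫}, 𝔖.ord 𝔠.1.1 y := by
  simp only [ord_mul]
  exact finsum_add_distrib (𝔖.hasFiniteSupport_cuspOrd 𝔫 hx) (𝔖.hasFiniteSupport_cuspOrd 𝔫 hy)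

/-- The cusp sum of an inverse. [cite: MochizukiEtTh2009, §1 p.240 (PDF p.14)] -/
theorem cuspSum_inv (𝔖 : DivisorSupportDataQ 𝔓) (𝔫 : {p : Primes 𝔉.PhiAcirc // ¬ 𝔓.IsCuspidal p}) (x : Algebra.GrothendieckGroup 𝔉.PhiAcirc) :
    ∑ᶠ 𝔠 : {𝔠 : {p : Primes 𝔉.PhiAcirc // 𝔓.IsCuspidal p} // 𝔓.cspToNcsp 𝔠 = 𝔫}, 𝔖.ord 𝔠.1.1 x⁻¹ =
      -∑ᶠ 𝔠 : {𝔠 : {p : Primes 𝔉.PhiAcirc // 𝔓.IsCuspidal p} // 𝔓.cspToNcsp 𝔠 = 𝔫}, 𝔖.ord 𝔠.1.1 x := by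
  simp only [ord_inv]
  exact finsum_neg_distrib _

/-- `degOn` is additive on elements of finite support. [cite: MochizukiEtTh2009, §1 p.240 (PDF p.14)] -/
theorem degOn_mul (𝔖 : DivisorSupportDataQ 𝔓) (𝔫 : {p : Primes 𝔉.PhiAcirc // ¬ 𝔓.IsCuspidal p})
    {x y : Algebra.GrothendieckGroup 𝔉.PhiAcirc} (hx : (𝔖.supp x).Finite) (hy : (𝔖.supp y).Finite) :
    𝔖.degOn 𝔫 (x * y) = 𝔖.degOn 𝔫 x + 𝔖.degOn 𝔫 y := by
  rw [degOn_eq, degOn_eq, degOn_eq, vert_mul, 𝔖.cuspSum_mul 𝔫 hx hy]; ring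

/-- `degOn` of an inverse. [cite: MochizukiEtTh2009, §1 p.240 (PDF p.14)] -/
theorem degOn_inv (𝔖 : DivisorSupportDataQ 𝔓) (𝔫 : {p : Primes 𝔉.PhiAcirc // ¬ 𝔓.IsCuspidal p}) (x : Algebra.GrothendieckGroup 𝔉.PhiAcirc) :
    𝔖.degOn 𝔫 x⁻¹ = -𝔖.degOn 𝔫 x := by
  rw [degOn_eq, degOn_eq, vert_inv, cuspSum_inv]; ring

/-- The cusp sum of an element of `Φ(A_⊚)` is non-negative (no finiteness needed).
[cite: MochizukiEtTh2009, Prop 5.3 proof p.326 (PDF p.100)] -/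
theorem cuspSum_of_nonneg (𝔖 : DivisorSupportDataQ 𝔓) (𝔫 : {p : Primes 𝔉.PhiAcirc // ¬ 𝔓.IsCuspidal p}) (b : 𝔉.PhiAcirc) :
    0 ≤ ∑ᶠ 𝔠 : {𝔠 : {p : Primes 𝔉.PhiAcirc // 𝔓.IsCuspidal p} // 𝔓.cspToNcsp 𝔠 = 𝔫},
      𝔖.ord 𝔠.1.1 (Algebra.GrothendieckGroup.of b) :=
  finsum_nonneg fun _ => 𝔖.ord_of_nonneg _ _

/-- The cusp sum on `𝔫` of an element with a single CUSPIDAL coordinate `m` at `𝔞`: `m` if `𝔞 ↦ 𝔫`, else `0`.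
[cite: MochizukiEtTh2009, Prop 5.3 proof p.326 (PDF p.100)] -/
theorem cuspSum_of_cusp (𝔖 : DivisorSupportDataQ 𝔓) (𝔫 : {p : Primes 𝔉.PhiAcirc // ¬ 𝔓.IsCuspidal p}) {𝔞 : Primes 𝔉.PhiAcirc}
    (h𝔞 : 𝔓.IsCuspidal 𝔞) {x : Algebra.GrothendieckGroup 𝔉.PhiAcirc} {m : ℚ} (h𝔞x : 𝔖.ord 𝔞 x = m)
    (hx : ∀ 𝔮, 𝔮 ≠ 𝔞 → 𝔖.ord 𝔮 x = 0) :
    ∑ᶠ 𝔠 : {𝔠 : {p : Primes 𝔉.PhiAcirc // 𝔓.IsCuspidal p} // 𝔓.cspToNcsp 𝔠 = 𝔫}, 𝔖.ord 𝔠.1.1 x =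
      if 𝔓.cspToNcsp ⟨𝔞, h𝔞⟩ = 𝔫 then m else 0 := by
  split_ifs with h
  · rw [finsum_eq_single _
      (⟨⟨𝔞, h𝔞⟩, h⟩ : {𝔠 : {p : Primes 𝔉.PhiAcirc // 𝔓.IsCuspidal p} // 𝔓.cspToNcsp 𝔠 = 𝔫})]
    · exact h𝔞x
    · intro 𝔠 h𝔠
      exact hx _ fun h' => h𝔠 (Subtype.ext (Subtype.ext h'))
  · apply finsum_eq_zero_of_forall_eq_zero
    intro 𝔠
    apply hx
    intro h'
    apply h
    have : 𝔠.1 = ⟨𝔞, h𝔞⟩ := Subtype.ext h'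
    rw [← this]; exact 𝔠.2

/-- The cusp sum vanishes on an element with no cuspidal prime in its support (e.g. one supported on
components).  [cite: MochizukiEtTh2009, Prop 5.3 proof p.326 (PDF p.100)] -/
theorem cuspSum_eq_zero_of_forall (𝔖 : DivisorSupportDataQ 𝔓) (𝔫 : {p : Primes 𝔉.PhiAcirc // ¬ 𝔓.IsCuspidal p})
    {x : Algebra.GrothendieckGroup 𝔉.PhiAcirc}
    (hx : ∀ 𝔠 : Primes 𝔉.PhiAcirc, 𝔓.IsCuspidal 𝔠 → 𝔖.ord 𝔠 x = 0) :
    ∑ᶠ 𝔠 : {𝔠 : {p : Primes 𝔉.PhiAcirc // 𝔓.IsCuspidal p} // 𝔓.cspToNcsp 𝔠 = 𝔫}, 𝔖.ord 𝔠.1.1 x = 0 :=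
  finsum_eq_zero_of_forall_eq_zero fun 𝔠 => hx _ 𝔠.1.2

/-- The vertical part on `𝔫` of an element `x` with a single coordinate `k` at `𝔫₀` (and `0` at every other
prime): `k·([𝔫⁻ = 𝔫₀] − 2[𝔫 = 𝔫₀] + [𝔫⁺ = 𝔫₀])`. [cite: MochizukiEtTh2009, §1 p.240 (PDF p.14)] -/
theorem vert_of_single (𝔖 : DivisorSupportDataQ 𝔓) (𝔫 : {p : Primes 𝔉.PhiAcirc // ¬ 𝔓.IsCuspidal p}) {𝔫₀ : Primes 𝔉.PhiAcirc}
    {x : Algebra.GrothendieckGroup 𝔉.PhiAcirc} {k : ℚ} (h₀ : 𝔖.ord 𝔫₀ x = k)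
    (hx : ∀ 𝔮, 𝔮 ≠ 𝔫₀ → 𝔖.ord 𝔮 x = 0) :
    𝔖.ord (ncspShift 𝔓 (-1) 𝔫).1 x - 2 * 𝔖.ord 𝔫.1 x + 𝔖.ord (ncspShift 𝔓 1 𝔫).1 x =
      k * ((if (ncspShift 𝔓 (-1) 𝔫).1 = 𝔫₀ then 1 else 0) - 2 * (if 𝔫.1 = 𝔫₀ then 1 else 0) +
        (if (ncspShift 𝔓 1 𝔫).1 = 𝔫₀ then 1 else 0)) := by
  have hval : ∀ 𝔮 : Primes 𝔉.PhiAcirc, 𝔖.ord 𝔮 x = k * (if 𝔮 = 𝔫₀ then 1 else 0) := by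
    intro 𝔮; split_ifs with h
    · rw [h, h₀, mul_one]
    · rw [hx 𝔮 h, mul_zero]
  simp only [hval]; ring

/-! ### Integral elements -/

/-- `1` is integral. [cite: MochizukiEtTh2009, Prop 3.2 (i) p.296 (PDF p.70)] -/
theorem integral_one (𝔖 : DivisorSupportDataQ 𝔓) : 𝔖.Integral 1 := fun 𝔭 => ⟨0, by rw [ord_one, Int.cast_zero]⟩

/-- Products of integral elements are integral. [cite: MochizukiEtTh2009, Prop 3.2 (i) p.296 (PDF p.70)] -/
theorem integral_mul (𝔖 : DivisorSupportDataQ 𝔓) {x y : Algebra.GrothendieckGroup 𝔉.PhiAcirc} (hx : 𝔖.Integral x) (hy : 𝔖.Integral y) :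
    𝔖.Integral (x * y) := fun 𝔭 => by
  obtain ⟨a, ha⟩ := hx 𝔭
  obtain ⟨b, hb⟩ := hy 𝔭
  exact ⟨a + b, by rw [ord_mul, ha, hb, Int.cast_add]⟩

/-- Inverses of integral elements are integral. [cite: MochizukiEtTh2009, Prop 3.2 (i) p.296 (PDF p.70)] -/
theorem integral_inv (𝔖 : DivisorSupportDataQ 𝔓) {x : Algebra.GrothendieckGroup 𝔉.PhiAcirc} (hx : 𝔖.Integral x) : 𝔖.Integral x⁻¹ := fun 𝔭 => by
  obtain ⟨a, ha⟩ := hx 𝔭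
  exact ⟨-a, by rw [ord_inv, ha, Int.cast_neg]⟩

/-- Powers of integral elements are integral. [cite: MochizukiEtTh2009, Prop 3.2 (i) p.296 (PDF p.70)] -/
theorem integral_pow (𝔖 : DivisorSupportDataQ 𝔓) {x : Algebra.GrothendieckGroup 𝔉.PhiAcirc} (hx : 𝔖.Integral x) (n : ℕ) : 𝔖.Integral (x ^ n) :=
  fun 𝔭 => by
  obtain ⟨a, ha⟩ := hx 𝔭
  exact ⟨n * a, by rw [ord_pow, ha]; push_cast; ring⟩

/-- Integer powers of integral elements are integral. [cite: MochizukiEtTh2009, Prop 3.2 (i) p.296 (PDF p.70)] -/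
theorem integral_zpow (𝔖 : DivisorSupportDataQ 𝔓) {x : Algebra.GrothendieckGroup 𝔉.PhiAcirc} (hx : 𝔖.Integral x) (n : ℤ) : 𝔖.Integral (x ^ n) :=
  fun 𝔭 => by
  obtain ⟨a, ha⟩ := hx 𝔭
  exact ⟨n * a, by rw [ord_zpow, ha]; push_cast; ring⟩

/-- Finite products of integral elements are integral. [cite: MochizukiEtTh2009, Prop 3.2 (i) p.296 (PDF p.70)] -/
theorem integral_prod (𝔖 : DivisorSupportDataQ 𝔓) {ι : Type*} (s : Finset ι) (f : ι → Algebra.GrothendieckGroup 𝔉.PhiAcirc)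
    (hf : ∀ i ∈ s, 𝔖.Integral (f i)) : 𝔖.Integral (∏ i ∈ s, f i) := by
  induction s using Finset.induction_on with
  | empty => rw [Finset.prod_empty]; exact 𝔖.integral_one
  | insert i s hi ih =>
    rw [Finset.prod_insert hi]
    exact 𝔖.integral_mul (hf i (Finset.mem_insert_self i s)) (ih fun j hj => hf j (Finset.mem_insert_of_mem hj))

/-- The prime log-divisors are integral. [cite: MochizukiEtTh2009, Prop 5.3 p.325 (PDF p.99)] -/
theorem integral_of_gen (𝔖 : DivisorSupportDataQ 𝔓) (𝔭 : Primes 𝔉.PhiAcirc) : 𝔖.Integral (Algebra.GrothendieckGroup.of (𝔖.gen 𝔭)) := fun 𝔮 => by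
  rw [ord_gen]
  split_ifs
  · exact ⟨1, by rw [Int.cast_one]⟩
  · exact ⟨0, by rw [Int.cast_zero]⟩

/-- Under the binder, principal elements are integral with all degrees `0`; conversely.
[cite: MochizukiEtTh2009, §1 p.240 (PDF p.14)] -/
theorem isPrincipal_iff_mem (𝔖 : DivisorSupportDataQ 𝔓) (z : Algebra.GrothendieckGroup 𝔉.PhiAcirc) :
    𝔖.IsPrincipal z ↔ z ∈ 𝔖.principal := by
  rw [IsPrincipal, IsPrincipalOf, LinEquivOf, inv_one, mul_one]

end DivisorSupportDataQ


end FrobenioidThetaDivisors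

end Literature.AnabelianGeometry.EtaleTheta
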